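import Mathlib
import HarnessLib

/-!
# Ichino (2022), §4.1 and Lemma 7.10: the `K × K′`-types in the joint harmonics of the Fock model
# of the Weil representation `ω_{V,W,χ_V,χ_W,ψ}` of `U(p,q) × U(r,s)` WITH SPLITTING CHARACTERS

Reproduction (dictionary level for the Fock model, REAL definitions for the weights) of:
A. Ichino, *Theta lifting for tempered representations of real unitary groups*, Adv. Math. **398**
(2022) 108188 = arXiv:2008.06174 [Ichino2022ThetaReal] (held text `paper:arxiv-2008.06174` = the arXiv LaTeX source, chunks p0009
= §4.1 and p0020 = §7.5 Lemma 7.10; chunk indices, not folios — the journal version is article 108188 and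
its §/Lemma numbers agree with arXiv v3; quotations verbatim).

**§4.1 Setup** (p0009 L9–22): "We consider the theta lifting from `U(W)` to `U(V)`, where `W` is an
`n`-dimensional skew-Hermitian space over `ℂ` and `V` is an `m`-dimensional Hermitian space over `ℂ`.
Let `(p,q)` and `(r,s)` be the signatures of `W` and `V`, respectively, so that `p+q = n` and `r+s = m`.
… From now on, we take the characters `χ_V, χ_W` of `ℂ^×` given by `χ_V(z) = (z/√(z z̄))^{m₀}`,
`χ_W(z) = (z/√(z z̄))^{n₀}` for some fixed integers `m₀, n₀` such that `m₀ ≡ m mod 2`, `n₀ ≡ n mod 2`,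
and the character `ψ` of `ℝ` given by `ψ(x) = e^{−2π√−1 x}`. (We make this choice so that Lemma 7.10
below holds.)"

**§7.5** (p0019 L130–p0020 L8): "We take the maximal compact subgroup `K ≅ U(p) × U(q)` of
`U(W) = U(p,q)` as in §3.1 and parametrize the irreducible representations of `K` by highest weights
`(a₁, …, a_p; b₁, …, b_q)`, where `a_i, b_j ∈ ℤ`; `a₁ ≥ ⋯ ≥ a_p` and `b₁ ≥ ⋯ ≥ b_q`. Similarly, we take
the maximal compact subgroup `K′ ≅ U(r) × U(s)` of `U(V) = U(r,s)` and parametrize the irreducible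
representations of `K′`. … Let `𝒫 = ⊕_{d=0}^∞ 𝒫_d` be the Fock model of the Weil representation
`ω_{V,W,χ_V,χ_W,ψ}` of `U(W) × U(V)` relative to the datum `(χ_V, χ_W, ψ)` given in §4.1, where `𝒫` is
the space of polynomials in `mn` variables and `𝒫_d` is the subspace of homogeneous polynomials of
degree `d`. … Let `ℋ` be the space of joint harmonics, which is a `K × K′`-invariant subspace of `𝒫`.
For any irreducible representations `μ` and `μ′` of `K` and `K′`, respectively, we say that `μ` and
`μ′` correspond if `μ ⊠ μ′` occurs in `ℋ`, in which case `μ` and `μ′` determine each other."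

**Lemma 7.10** (p0020 L9–22), verbatim: "Let `μ` and `μ′` be irreducible representations of `K` and
`K′`, respectively. Then `μ` and `μ′` correspond if and only if `μ` and `μ′` are of the form
`μ = (a₁, …, a_{p⁺}, 0, …, 0, b₁, …, b_{p⁻}; c₁, …, c_{q⁺}, 0, …, 0, d₁, …, d_{q⁻})`
`    + ((r−s)/2, …, (r−s)/2; (s−r)/2, …, (s−r)/2) + (m₀/2, …, m₀/2)`
and
`μ′ = (a₁, …, a_{p⁺}, 0, …, 0, d₁, …, d_{q⁻}; c₁, …, c_{q⁺}, 0, …, 0, b₁, …, b_{p⁻})`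
`    + ((p−q)/2, …, (p−q)/2; (q−p)/2, …, (q−p)/2) + (n₀/2, …, n₀/2)`,
where `a_i, b_j, c_k, d_l ∈ ℤ`; `a₁ ≥ ⋯ ≥ a_{p⁺} > 0 > b₁ ≥ ⋯ ≥ b_{p⁻}` and
`c₁ ≥ ⋯ ≥ c_{q⁺} > 0 > d₁ ≥ ⋯ ≥ d_{q⁻}`; `p⁺ + p⁻ ≤ p` and `q⁺ + q⁻ ≤ q`; `p⁺ + q⁻ ≤ r` and
`p⁻ + q⁺ ≤ s`."  (Proof there: "Given our choice of the datum `(χ_V, χ_W, ψ)`, the assertion follows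
from [Konno–Konno, Kyushu J. Math. 61 (2007)]." The metaplectic-normalised version without splitting
characters is A. Paul, J. Funct. Anal. 159 (1998) Lemma 1.4.5, and for compact `U(p)` J. Adams 2007
Prop 6.6 = `Literature.RepresentationTheory.Adams2007.UpUmnTheta.Prop_6_6`; the present lemma is the
one that carries the two splitting characters `χ_V = (·/|·|)^{m₀}`, `χ_W = (·/|·|)^{n₀}`.)

## Transcription level

* `SplittingDatum` — the integers `p q r s m₀ n₀` of §4.1 with the two parity constraints (REAL data).
* `HarmonicParam S`, `HarmonicParam.mu`, `HarmonicParam.mu'` — the parameters and the two highest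
  weights of Lemma 7.10 as REAL definitions (rational vectors, because of the half-integral shifts).
* `FockHarmonics S` — DICTIONARY: the relation "`μ ⊠ μ′` occurs in the joint harmonics `ℋ`" of the Fock
  model, indexed by highest weights; `FockHarmonics.Lemma_7_10` — the lemma AS A PREDICATE on the
  dictionary.  NOTHING IS ASSERTED (the tree has no Fock model / Weil representation over `ℝ`);
  consumers take `(h : D.Lemma_7_10)` as a hypothesis.
* Proved here (arithmetic on the weights; complete proofs): the vacuum pair `vacuum_corresponds`; for
  `q = 0` every parameter has `q⁺ = q⁻ = 0` (`HarmonicParam.qp_eq_zero` …); and four WORKED LINES used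
  by the `U(2,1)` theta-lift bookkeeping of Picard modular surfaces:
  - `(p,q;r,s) = (1,0;3,0)` (`corresponds_trivial_iff_1030`): the trivial `K′ = U(3)`-type is harmonic
    iff `n₀ = −1`, and then it is paired with the `U(1)`-character of weight `(3 + m₀)/2`;
  - `(0,1;3,0)` (`corresponds_trivial_iff_0130`): iff `n₀ = +1`, paired with weight `(m₀ − 3)/2`;
  - `(1,0;2,1)` (`corresponds_pPlus_iff_1021`): the `K′ = U(2) × U(1)`-type `(1,0;−1)` is harmonic iff
    `n₀ = −1`, and then it is paired with the `U(1)`-character of weight `(3 + m₀)/2`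
    (`= 1 + (1 + m₀)/2`); `corresponds_vacuum_iff_1021`;
  - `(0,1;2,1)` (`not_corresponds_pPlus_0121`): `(1,0;−1)` is never harmonic.

NOT here: the Fock model itself, the joint harmonics `ℋ`, the `(r,s)`-degree, Lemma 7.11, Theorems
4.1–4.5 (the theta lifts as `A_𝔮(λ)`), the nonarchimedean part (§8 ff.).

## References

* A. Ichino, Adv. Math. 398 (2022) 108188, §4.1, §7.5 Lemma 7.10. [Ichino2022ThetaReal]
* A. Paul, J. Funct. Anal. 159 (1998) 384–431, Lemma 1.4.5 (metaplectic normalisation).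
* K. Konno, T. Konno, Kyushu J. Math. 61 (2007) 35–82 (Ichino's source for 7.10).
* J. Adams 2007 §6 Prop 6.6 = `Literature.RepresentationTheory.Adams2007.UpUmnTheta` (compact `U(p)`).
-/

namespace Literature.RepresentationTheory.Ichino2022

/-! ## §4.1: the splitting datum -/

/-- **Ichino §4.1 set-up** as integers: `W` skew-Hermitian of signature `(p,q)` (`n = p+q`), `V` Hermitian
of signature `(r,s)` (`m = r+s`), and the exponents of the splitting characters
`χ_V(z) = (z/|z|)^{m₀}`, `χ_W(z) = (z/|z|)^{n₀}` with `m₀ ≡ m`, `n₀ ≡ n (mod 2)`.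
[cite: Ichino2022ThetaReal, §4.1] -/
structure SplittingDatum where
  /-- signature of the skew-Hermitian space `W`: `U(W) = U(p,q)` -/
  p : ℕ
  /-- signature of `W` -/
  q : ℕ
  /-- signature of the Hermitian space `V`: `U(V) = U(r,s)` -/
  r : ℕ
  /-- signature of `V` -/
  s : ℕ
  /-- exponent of `χ_V` -/
  m₀ : ℤ
  /-- exponent of `χ_W` -/
  n₀ : ℤ
  /-- `m₀ ≡ m = r + s (mod 2)` -/
  m₀_parity : m₀ ≡ (r : ℤ) + s [ZMOD 2]
  /-- `n₀ ≡ n = p + q (mod 2)` -/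
  n₀_parity : n₀ ≡ (p : ℤ) + q [ZMOD 2]

/-- Highest weights of `K = U(p) × U(q)` (resp. `K′ = U(r) × U(s)`) written, as in Lemma 7.10, as rational
vectors `(x₁, …, x_p; y₁, …, y_q)` (integers plus the half-integral shifts). [cite: Ichino2022ThetaReal, §7.5] -/
abbrev KWt (p q : ℕ) : Type := (Fin p → ℚ) × (Fin q → ℚ)

/-- The block vector `(x₁, …, x_k, 0, …, 0, y₁, …, y_l)` of length `N` (`k + l ≤ N`), as in the two
displays of Lemma 7.10. [cite: Ichino2022ThetaReal, §7.5 Lemma 7.10] -/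
def pad (N k l : ℕ) (h : k + l ≤ N) (x : Fin k → ℤ) (y : Fin l → ℤ) : Fin N → ℚ := fun i =>
  if h₁ : i.val < k then (x ⟨i.val, h₁⟩ : ℚ)
  else if h₂ : N - l ≤ i.val then (y ⟨i.val - (N - l), by omega⟩ : ℚ) else 0

/-! ## Lemma 7.10: parameters and the two weights -/

/-- **The parameters of Lemma 7.10**: `p⁺, p⁻, q⁺, q⁻` and integer strings
`a₁ ≥ ⋯ ≥ a_{p⁺} > 0 > b₁ ≥ ⋯ ≥ b_{p⁻}`, `c₁ ≥ ⋯ ≥ c_{q⁺} > 0 > d₁ ≥ ⋯ ≥ d_{q⁻}`, subject to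
`p⁺ + p⁻ ≤ p`, `q⁺ + q⁻ ≤ q`, `p⁺ + q⁻ ≤ r`, `p⁻ + q⁺ ≤ s`. [cite: Ichino2022ThetaReal, §7.5 Lemma 7.10] -/
structure HarmonicParam (S : SplittingDatum) where
  /-- `p⁺` -/
  pp : ℕ
  /-- `p⁻` -/
  pm : ℕ
  /-- `q⁺` -/
  qp : ℕ
  /-- `q⁻` -/
  qm : ℕ
  /-- `a₁, …, a_{p⁺}` -/
  a : Fin pp → ℤ
  /-- `b₁, …, b_{p⁻}` -/
  b : Fin pm → ℤ
  /-- `c₁, …, c_{q⁺}` -/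
  c : Fin qp → ℤ
  /-- `d₁, …, d_{q⁻}` -/
  d : Fin qm → ℤ
  /-- `a` non-increasing -/
  a_anti : Antitone a
  /-- `b` non-increasing -/
  b_anti : Antitone b
  /-- `c` non-increasing -/
  c_anti : Antitone c
  /-- `d` non-increasing -/
  d_anti : Antitone d
  /-- `a_i > 0` -/
  a_pos : ∀ i, 0 < a i
  /-- `b_j < 0` -/
  b_neg : ∀ j, b j < 0
  /-- `c_k > 0` -/
  c_pos : ∀ k, 0 < c k
  /-- `d_l < 0` -/
  d_neg : ∀ l, d l < 0
  /-- `p⁺ + p⁻ ≤ p` -/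
  hp : pp + pm ≤ S.p
  /-- `q⁺ + q⁻ ≤ q` -/
  hq : qp + qm ≤ S.q
  /-- `p⁺ + q⁻ ≤ r` -/
  hr : pp + qm ≤ S.r
  /-- `p⁻ + q⁺ ≤ s` -/
  hs : pm + qp ≤ S.s

namespace HarmonicParam

variable {S : SplittingDatum} (P : HarmonicParam S)

/-- `μ = (a, 0, b; c, 0, d) + ((r−s)/2, …; (s−r)/2, …) + (m₀/2, …, m₀/2)`, the `K = U(p) × U(q)`-type of
Lemma 7.10. [cite: Ichino2022ThetaReal, §7.5 Lemma 7.10] -/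
def mu : KWt S.p S.q :=
  (fun i => pad S.p P.pp P.pm P.hp P.a P.b i + ((S.r : ℚ) - S.s) / 2 + (S.m₀ : ℚ) / 2,
   fun j => pad S.q P.qp P.qm P.hq P.c P.d j + ((S.s : ℚ) - S.r) / 2 + (S.m₀ : ℚ) / 2)

/-- `μ′ = (a, 0, d; c, 0, b) + ((p−q)/2, …; (q−p)/2, …) + (n₀/2, …, n₀/2)`, the `K′ = U(r) × U(s)`-type of
Lemma 7.10. [cite: Ichino2022ThetaReal, §7.5 Lemma 7.10] -/
def mu' : KWt S.r S.s :=
  (fun i => pad S.r P.pp P.qm P.hr P.a P.d i + ((S.p : ℚ) - S.q) / 2 + (S.n₀ : ℚ) / 2,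
   fun j => pad S.s P.qp P.pm (by have := P.hs; omega) P.c P.b j + ((S.q : ℚ) - S.p) / 2 +
     (S.n₀ : ℚ) / 2)

/-- When `q = 0` (compact `U(W) = U(p)`), the `c`- and `d`-strings are empty. [cite: Ichino2022ThetaReal, §7.5 Lemma 7.10] -/
theorem qp_eq_zero (hq : S.q = 0) : P.qp = 0 := by have := P.hq; omega

/-- When `q = 0`, `q⁻ = 0`. [cite: Ichino2022ThetaReal, §7.5 Lemma 7.10] -/
theorem qm_eq_zero (hq : S.q = 0) : P.qm = 0 := by have := P.hq; omega

/-- When `p = 0`, `p⁺ = 0`. [cite: Ichino2022ThetaReal, §7.5 Lemma 7.10] -/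
theorem pp_eq_zero (hp : S.p = 0) : P.pp = 0 := by have := P.hp; omega

/-- When `p = 0`, `p⁻ = 0`. [cite: Ichino2022ThetaReal, §7.5 Lemma 7.10] -/
theorem pm_eq_zero (hp : S.p = 0) : P.pm = 0 := by have := P.hp; omega

/-- When `s = 0` (compact `U(V) = U(r)`), `p⁻ = 0`. [cite: Ichino2022ThetaReal, §7.5 Lemma 7.10] -/
theorem pm_eq_zero_of_s (hs : S.s = 0) : P.pm = 0 := by have := P.hs; omega

/-- When `s = 0`, `q⁺ = 0`. [cite: Ichino2022ThetaReal, §7.5 Lemma 7.10] -/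
theorem qp_eq_zero_of_s (hs : S.s = 0) : P.qp = 0 := by have := P.hs; omega

end HarmonicParam

/-- The parameter with all four strings empty (the constants of `𝒫`). [cite: Ichino2022ThetaReal, §7.5 Lemma 7.10] -/
def HarmonicParam.vacuum (S : SplittingDatum) : HarmonicParam S where
  pp := 0
  pm := 0
  qp := 0
  qm := 0
  a := Fin.elim0
  b := Fin.elim0
  c := Fin.elim0
  d := Fin.elim0
  a_anti := fun i => i.elim0
  b_anti := fun i => i.elim0
  c_anti := fun i => i.elim0
  d_anti := fun i => i.elim0
  a_pos := fun i => i.elim0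
  b_neg := fun i => i.elim0
  c_pos := fun i => i.elim0
  d_neg := fun i => i.elim0
  hp := by omega
  hq := by omega
  hr := by omega
  hs := by omega

/-- With both strings empty the block vector vanishes. [folklore] -/
theorem pad_empty (N : ℕ) (h : 0 + 0 ≤ N) (i : Fin N) :
    pad N 0 0 h Fin.elim0 Fin.elim0 i = 0 := by
  unfold pad
  have hi : ¬ (N - 0 ≤ i.val) := by have := i.isLt; omega
  simp only [Nat.not_lt_zero, dite_false, hi]

/-- The vacuum weights: `μ_vac = ((r−s+m₀)/2, …; (s−r+m₀)/2, …)`, `μ′_vac = ((p−q+n₀)/2, …; (q−p+n₀)/2, …)`.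
[cite: Ichino2022ThetaReal, §7.5 Lemma 7.10] -/
theorem HarmonicParam.vacuum_mu (S : SplittingDatum) :
    (HarmonicParam.vacuum S).mu =
      (fun _ => ((S.r : ℚ) - S.s) / 2 + (S.m₀ : ℚ) / 2, fun _ => ((S.s : ℚ) - S.r) / 2 + (S.m₀ : ℚ) / 2) := by
  ext i <;> simp [HarmonicParam.mu, HarmonicParam.vacuum, pad_empty]

/-- See `HarmonicParam.vacuum_mu`. [cite: Ichino2022ThetaReal, §7.5 Lemma 7.10] -/
theorem HarmonicParam.vacuum_mu' (S : SplittingDatum) :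
    (HarmonicParam.vacuum S).mu' =
      (fun _ => ((S.p : ℚ) - S.q) / 2 + (S.n₀ : ℚ) / 2, fun _ => ((S.q : ℚ) - S.p) / 2 + (S.n₀ : ℚ) / 2) := by
  ext i <;> simp [HarmonicParam.mu', HarmonicParam.vacuum, pad_empty]

/-! ## The dictionary and the lemma as a predicate -/

/-- Dictionary for Ichino §7.5: `corresponds μ μ′` — "`μ ⊠ μ′` occurs in `ℋ`", the joint harmonics of the
Fock model `𝒫` of `ω_{V,W,χ_V,χ_W,ψ}`, for `μ`, `μ′` irreducible representations of `K = U(p) × U(q)`,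
`K′ = U(r) × U(s)` given by their highest weights. [cite: Ichino2022ThetaReal, §7.5] -/
structure FockHarmonics (S : SplittingDatum) where
  /-- `μ` and `μ′` correspond (`μ ⊠ μ′ ⊂ ℋ`) -/
  corresponds : KWt S.p S.q → KWt S.r S.s → Prop

namespace FockHarmonics

variable {S : SplittingDatum} (D : FockHarmonics S)

/-- **Ichino Lemma 7.10**, transcribed: `μ` and `μ′` correspond iff `(μ, μ′) = (P.mu, P.mu′)` for some
parameter `P` of the lemma. [cite: Ichino2022ThetaReal, §7.5 Lemma 7.10] -/
def Lemma_7_10 : Prop :=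
  ∀ (μ : KWt S.p S.q) (μ' : KWt S.r S.s), D.corresponds μ μ' ↔ ∃ P : HarmonicParam S, μ = P.mu ∧ μ' = P.mu'

/-- The constants: `μ_vac ↔ μ′_vac` correspond. [cite: Ichino2022ThetaReal, §7.5 Lemma 7.10] -/
theorem vacuum_corresponds (h : D.Lemma_7_10) :
    D.corresponds
      (fun _ => ((S.r : ℚ) - S.s) / 2 + (S.m₀ : ℚ) / 2, fun _ => ((S.s : ℚ) - S.r) / 2 + (S.m₀ : ℚ) / 2)
      (fun _ => ((S.p : ℚ) - S.q) / 2 + (S.n₀ : ℚ) / 2, fun _ => ((S.q : ℚ) - S.p) / 2 + (S.n₀ : ℚ) / 2) :=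
  (h _ _).mpr ⟨HarmonicParam.vacuum S, (HarmonicParam.vacuum_mu S).symm, (HarmonicParam.vacuum_mu' S).symm⟩

/-- "`μ` and `μ′` determine each other", first half, in the weak form the lemma gives at once: a `μ′`
corresponding to some `μ` is of the form `P.mu′`. [cite: Ichino2022ThetaReal, §7.5 Lemma 7.10] -/
theorem exists_param_of_corresponds (h : D.Lemma_7_10) {μ : KWt S.p S.q} {μ' : KWt S.r S.s}
    (hc : D.corresponds μ μ') : ∃ P : HarmonicParam S, μ = P.mu ∧ μ' = P.mu' :=
  (h μ μ').mp hc

end FockHarmonics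

/-! ## Small API for the block vectors (used by the worked lines) -/

/-- Head block: for `i < k`, `pad … i = x_i`. [folklore] -/
theorem pad_head {N k l : ℕ} (h : k + l ≤ N) (x : Fin k → ℤ) (y : Fin l → ℤ) (i : Fin N)
    (hi : i.val < k) : pad N k l h x y i = (x ⟨i.val, hi⟩ : ℚ) := by
  unfold pad
  simp only [hi, dite_true]

/-- Middle block: for `k ≤ i < N − l`, `pad … i = 0`. [folklore] -/
theorem pad_mid {N k l : ℕ} (h : k + l ≤ N) (x : Fin k → ℤ) (y : Fin l → ℤ) (i : Fin N)
    (h₁ : k ≤ i.val) (h₂ : i.val < N - l) : pad N k l h x y i = 0 := by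
  unfold pad
  have h₁' : ¬ (i.val < k) := by omega
  have h₂' : ¬ (N - l ≤ i.val) := by omega
  simp only [h₁', dite_false, h₂']

/-- Tail block: for `N − l ≤ i` (and `k ≤ i`), `pad … i = y_{i − (N − l)}`. [folklore] -/
theorem pad_tail {N k l : ℕ} (h : k + l ≤ N) (x : Fin k → ℤ) (y : Fin l → ℤ) (i : Fin N)
    (h₁ : k ≤ i.val) (h₂ : N - l ≤ i.val) :
    pad N k l h x y i = (y ⟨i.val - (N - l), by have := i.isLt; omega⟩ : ℚ) := by
  unfold pad
  have h₁' : ¬ (i.val < k) := by omega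
  simp only [h₁', dite_false, h₂, dite_true]

namespace HarmonicParam

variable {S : SplittingDatum} (P : HarmonicParam S)

/-- The `i`-th entry of the `U(p)`-half of `μ`. [cite: Ichino2022ThetaReal, §7.5 Lemma 7.10] -/
theorem mu_fst_apply (i : Fin S.p) :
    P.mu.1 i = pad S.p P.pp P.pm P.hp P.a P.b i + ((S.r : ℚ) - S.s) / 2 + (S.m₀ : ℚ) / 2 := rfl

/-- The `j`-th entry of the `U(q)`-half of `μ`. [cite: Ichino2022ThetaReal, §7.5 Lemma 7.10] -/
theorem mu_snd_apply (j : Fin S.q) :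
    P.mu.2 j = pad S.q P.qp P.qm P.hq P.c P.d j + ((S.s : ℚ) - S.r) / 2 + (S.m₀ : ℚ) / 2 := rfl

/-- The `i`-th entry of the `U(r)`-half of `μ′`. [cite: Ichino2022ThetaReal, §7.5 Lemma 7.10] -/
theorem mu'_fst_apply (i : Fin S.r) :
    P.mu'.1 i = pad S.r P.pp P.qm P.hr P.a P.d i + ((S.p : ℚ) - S.q) / 2 + (S.n₀ : ℚ) / 2 := rfl

/-- The `j`-th entry of the `U(s)`-half of `μ′`. [cite: Ichino2022ThetaReal, §7.5 Lemma 7.10] -/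
theorem mu'_snd_apply (j : Fin S.s) :
    P.mu'.2 j = pad S.s P.qp P.pm (by have := P.hs; omega) P.c P.b j + ((S.q : ℚ) - S.p) / 2 +
      (S.n₀ : ℚ) / 2 := rfl

/-! ### Integrality: the displayed weights are integral (the parity constraints of §4.1) -/

/-- Every entry of a block vector is an integer. [folklore] -/
theorem _root_.Literature.RepresentationTheory.Ichino2022.pad_int {N k l : ℕ} (h : k + l ≤ N)
    (x : Fin k → ℤ) (y : Fin l → ℤ) (i : Fin N) : ∃ z : ℤ, pad N k l h x y i = (z : ℚ) := by
  unfold pad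
  split_ifs
  · exact ⟨_, rfl⟩
  · exact ⟨_, rfl⟩
  · exact ⟨0, by simp⟩

/-- The `U(p)`-entries of `μ` are INTEGERS: `(r − s + m₀)/2 ∈ ℤ` because `m₀ ≡ m = r + s (mod 2)` — so the
`ℚ`-valued `KWt` is only bookkeeping for the half-integral shifts; the printed lemma ranges over integral
highest weights. [cite: Ichino2022ThetaReal, §4.1 with §7.5 Lemma 7.10] -/
theorem mu_fst_int (i : Fin S.p) : ∃ z : ℤ, P.mu.1 i = (z : ℚ) := by
  obtain ⟨z, hz⟩ := pad_int P.hp P.a P.b i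
  obtain ⟨k, hk⟩ := S.m₀_parity.dvd
  refine ⟨z + S.r - k, ?_⟩
  have hm : (S.m₀ : ℚ) = S.r + S.s - 2 * k := by
    have : (S.m₀ : ℤ) = S.r + S.s - 2 * k := by linarith
    exact_mod_cast this
  rw [mu_fst_apply, hz, hm]
  push_cast
  ring

/-- The `U(q)`-entries of `μ` are integers. [cite: Ichino2022ThetaReal, §4.1 with §7.5 Lemma 7.10] -/
theorem mu_snd_int (j : Fin S.q) : ∃ z : ℤ, P.mu.2 j = (z : ℚ) := by
  obtain ⟨z, hz⟩ := pad_int P.hq P.c P.d j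
  obtain ⟨k, hk⟩ := S.m₀_parity.dvd
  refine ⟨z + S.s - k, ?_⟩
  have hm : (S.m₀ : ℚ) = S.r + S.s - 2 * k := by
    have : (S.m₀ : ℤ) = S.r + S.s - 2 * k := by linarith
    exact_mod_cast this
  rw [mu_snd_apply, hz, hm]
  push_cast
  ring

/-- The `U(r)`-entries of `μ′` are integers (`n₀ ≡ n = p + q`). [cite: Ichino2022ThetaReal, §4.1 with §7.5 Lemma 7.10] -/
theorem mu'_fst_int (i : Fin S.r) : ∃ z : ℤ, P.mu'.1 i = (z : ℚ) := by
  obtain ⟨z, hz⟩ := pad_int P.hr P.a P.d i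
  obtain ⟨k, hk⟩ := S.n₀_parity.dvd
  refine ⟨z + S.p - k, ?_⟩
  have hn : (S.n₀ : ℚ) = S.p + S.q - 2 * k := by
    have : (S.n₀ : ℤ) = S.p + S.q - 2 * k := by linarith
    exact_mod_cast this
  rw [mu'_fst_apply, hz, hn]
  push_cast
  ring

/-- The `U(s)`-entries of `μ′` are integers. [cite: Ichino2022ThetaReal, §4.1 with §7.5 Lemma 7.10] -/
theorem mu'_snd_int (j : Fin S.s) : ∃ z : ℤ, P.mu'.2 j = (z : ℚ) := by
  obtain ⟨z, hz⟩ := pad_int (by have := P.hs; omega) P.c P.b j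
  obtain ⟨k, hk⟩ := S.n₀_parity.dvd
  refine ⟨z + S.q - k, ?_⟩
  have hn : (S.n₀ : ℚ) = S.p + S.q - 2 * k := by
    have : (S.n₀ : ℤ) = S.p + S.q - 2 * k := by linarith
    exact_mod_cast this
  rw [mu'_snd_apply, hz, hn]
  push_cast
  ring

end HarmonicParam

end Literature.RepresentationTheory.Ichino2022
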